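import Summits.RiemannHypothesis.RiemannHypothesis.Theorems.WeilFormatCWindowLimit
import HarnessLib

/-!
# Format C (Fourier–Galerkin certificates of Weil positivity): the window form is parity-additive

Helper file (`--supports stmt-RiemannHypothesis-0098`, lead-track anchor), RH-free. Seat
rh-explicit-weil-3 (gen3). Sequel of `WeilFormatCWindowDictionary.lean`.

Format-C certificates are produced per PARITY SECTOR (FORMATC-DESIGN §1: the sector Grams `G^σ`,
`σ ∈ {even, odd}`). This file supplies the glue:

* the window form `weilWindowForm a` (`= P + 𝓔_a − M_a‖·‖₂²`) is **parity-additive**: for an even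
  window function `e` and an odd window function `o`,
  `weilWindowForm a (e + o) = weilWindowForm a e + weilWindowForm a o`
  (`weilWindowForm_add_of_even_odd`) — the pole form because `∫ o·cosh = ∫ e·sinh = 0`, the `L²` norm
  because `Re (e · conj o)` is odd, and EVERY increment `D_t` because the cross term
  `Re((e(x+t) − e(x)) · conj(o(x+t) − o(x)))` is odd under the reflection `x ↦ −x − t`;
* the sector dictionary itself (trigonometric windows, even/odd coefficient vectors) is the sequel
  `WeilFormatCWindowSectors.lean`.
-/

set_option autoImplicit false
set_option linter.dupNamespace false  -- the mandated namespace repeats `RiemannHypothesis`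

noncomputable section

open Complex Filter Set MeasureTheory
open scoped Real Topology ComplexConjugate

namespace Summit.RiemannHypothesis.RiemannHypothesis.Theorems.WeilFormatC

open Literature.NumberTheory.LFunctions

/-! ## Odd integrands integrate to zero -/

/-- An odd function `ℝ → ℂ` has integral zero (no integrability needed: both sides are the Bochner
integral). -/
private theorem integral_eq_zero_of_odd {f : ℝ → ℂ} (hf : ∀ x, f (-x) = -f x) : ∫ x, f x = 0 := by
  have h1 : ∫ x, f (-x) = ∫ x, f x := integral_neg_eq_self f volume
  have h2 : ∫ x, f (-x) = -∫ x, f x := by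
    rw [← integral_neg]
    exact integral_congr_ae (Eventually.of_forall fun x ↦ hf x)
  have h3 : (2 : ℂ) * ∫ x, f x = 0 := by rw [two_mul]; nth_rw 1 [← h1]; rw [h2]; ring
  simpa using h3

/-- A real function odd under the reflection `x ↦ −x − t` has integral zero. -/
private theorem integral_eq_zero_of_odd_reflect {f : ℝ → ℝ} {t : ℝ} (hf : ∀ x, f (-x - t) = -f x) :
    ∫ x, f x = 0 := by
  have h1 : ∫ x, f (-x - t) = ∫ x, f x := by
    have hA : ∫ x, (fun y ↦ f (-y)) (x + t) = ∫ x, (fun y ↦ f (-y)) x :=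
      integral_add_right_eq_self (fun y ↦ f (-y)) t
    have hB : ∫ x, f (-x) = ∫ x, f x := integral_neg_eq_self f volume
    simp only [neg_add_rev] at hA
    rw [← hB, ← hA]
    refine integral_congr_ae (Eventually.of_forall fun x ↦ ?_)
    ring_nf
  have h2 : ∫ x, f (-x - t) = -∫ x, f x := by
    rw [← integral_neg]
    exact integral_congr_ae (Eventually.of_forall fun x ↦ hf x)
  linarith

/-! ## Window functions: integrability -/

section Window

variable {a S Se So Le Lo : ℝ} {u e o : ℝ → ℂ}

/-- A bounded measurable function vanishing off `[-a, a]` times a continuous weight is integrable. -/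
theorem integrable_window_mul (hm : Measurable u) (hz : ∀ x, x ∉ Icc (-a) a → u x = 0)
    (hb : ∀ x, ‖u x‖ ≤ S) {w : ℝ → ℂ} (hw : Continuous w) :
    Integrable fun x ↦ u x * w x := by
  have hS : 0 ≤ S := (norm_nonneg _).trans (hb 0)
  have hint : Integrable fun x ↦ (Icc (-a) a).indicator (fun x ↦ S * ‖w x‖) x :=
    (integrable_indicator_iff measurableSet_Icc).2
      ((continuous_const.mul hw.norm).continuousOn.integrableOn_Icc)
  refine hint.mono' ((hm.mul hw.measurable).aestronglyMeasurable) (Eventually.of_forall fun x ↦ ?_)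
  by_cases hx : x ∈ Icc (-a) a
  · rw [indicator_of_mem hx, norm_mul]
    exact mul_le_mul_of_nonneg_right (hb x) (norm_nonneg _)
  · rw [hz x hx, indicator_of_notMem hx, zero_mul, norm_zero]

/-- The product of two bounded measurable functions vanishing off `[-a, a]` is integrable. -/
theorem integrable_window_mul_window (hme : Measurable e) (hze : ∀ x, x ∉ Icc (-a) a → e x = 0)
    (hbe : ∀ x, ‖e x‖ ≤ Se) (hmo : Measurable o) (hbo : ∀ x, ‖o x‖ ≤ So) :
    Integrable fun x ↦ e x * conj (o x) := by
  have hS : 0 ≤ Se := (norm_nonneg _).trans (hbe 0)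
  have hint : Integrable fun x ↦ (Icc (-a) a).indicator (fun _ ↦ Se * So) x :=
    (integrable_indicator_iff measurableSet_Icc).2 (integrableOn_const (by simp [Real.volume_Icc]))
  refine hint.mono' ((hme.mul (Complex.continuous_conj.measurable.comp hmo)).aestronglyMeasurable)
    (Eventually.of_forall fun x ↦ ?_)
  by_cases hx : x ∈ Icc (-a) a
  · rw [indicator_of_mem hx, norm_mul, Complex.norm_conj]
    exact mul_le_mul (hbe x) (hbo x) (norm_nonneg _) hS
  · rw [hze x hx, indicator_of_notMem hx, zero_mul, norm_zero]

/-! ## Parity-additivity of the window form -/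

/-- `∫ o(x) w(x) dx = 0` for `o` odd and `w` even. -/
theorem integral_mul_eq_zero_of_odd_even {w : ℝ → ℂ} (ho : ∀ x, o (-x) = -o x)
    (hw : ∀ x, w (-x) = w x) : ∫ x, o x * w x = 0 :=
  integral_eq_zero_of_odd fun x ↦ by rw [ho, hw]; ring

/-- `∫ e(x) w(x) dx = 0` for `e` even and `w` odd. -/
theorem integral_mul_eq_zero_of_even_odd {w : ℝ → ℂ} (he : ∀ x, e (-x) = e x)
    (hw : ∀ x, w (-x) = -w x) : ∫ x, e x * w x = 0 :=
  integral_eq_zero_of_odd fun x ↦ by rw [he, hw]; ring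

/-- **The pole form is parity-diagonal**: `P(e + o) = P(e) + P(o)` for an even and an odd window
function (`∫ o cosh(x/2) = 0 = ∫ e sinh(x/2)`). -/
theorem weilPoleForm_add_of_even_odd (hme : Measurable e) (hze : ∀ x, x ∉ Icc (-a) a → e x = 0)
    (hbe : ∀ x, ‖e x‖ ≤ Se) (hmo : Measurable o) (hzo : ∀ x, x ∉ Icc (-a) a → o x = 0)
    (hbo : ∀ x, ‖o x‖ ≤ So) (he : ∀ x, e (-x) = e x) (ho : ∀ x, o (-x) = -o x) :
    weilPoleForm (e + o) = weilPoleForm e + weilPoleForm o := by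
  have hc : Continuous fun x : ℝ ↦ ((Real.cosh (x / 2) : ℝ) : ℂ) :=
    Complex.continuous_ofReal.comp (Real.continuous_cosh.comp (continuous_id.div_const 2))
  have hs : Continuous fun x : ℝ ↦ ((Real.sinh (x / 2) : ℝ) : ℂ) :=
    Complex.continuous_ofReal.comp (Real.continuous_sinh.comp (continuous_id.div_const 2))
  have hcev : ∀ x : ℝ, ((Real.cosh (-x / 2) : ℝ) : ℂ) = ((Real.cosh (x / 2) : ℝ) : ℂ) := fun x ↦ by
    rw [neg_div, Real.cosh_neg]
  have hsod : ∀ x : ℝ, ((Real.sinh (-x / 2) : ℝ) : ℂ) = -((Real.sinh (x / 2) : ℝ) : ℂ) := fun x ↦ by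
    rw [neg_div, Real.sinh_neg]; push_cast; ring
  have h1 : ∫ x, (e + o) x * ((Real.cosh (x / 2) : ℝ) : ℂ) = ∫ x, e x * ((Real.cosh (x / 2) : ℝ) : ℂ) := by
    simp only [Pi.add_apply, add_mul]
    rw [integral_add (integrable_window_mul hme hze hbe hc) (integrable_window_mul hmo hzo hbo hc),
      integral_mul_eq_zero_of_odd_even ho hcev, add_zero]
  have h2 : ∫ x, (e + o) x * ((Real.sinh (x / 2) : ℝ) : ℂ) = ∫ x, o x * ((Real.sinh (x / 2) : ℝ) : ℂ) := by
    simp only [Pi.add_apply, add_mul]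
    rw [integral_add (integrable_window_mul hme hze hbe hs) (integrable_window_mul hmo hzo hbo hs),
      integral_mul_eq_zero_of_even_odd he hsod, zero_add]
  have h3 : ∫ x, o x * ((Real.cosh (x / 2) : ℝ) : ℂ) = 0 := integral_mul_eq_zero_of_odd_even ho hcev
  have h4 : ∫ x, e x * ((Real.sinh (x / 2) : ℝ) : ℂ) = 0 := integral_mul_eq_zero_of_even_odd he hsod
  unfold weilPoleForm
  rw [h1, h2, h3, h4, norm_zero]
  ring

/-- `‖z + w‖² = ‖z‖² + ‖w‖² + 2 Re(z · conj w)` in `ℂ`. -/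
private theorem norm_add_sq_complex (z w : ℂ) :
    ‖z + w‖ ^ 2 = ‖z‖ ^ 2 + ‖w‖ ^ 2 + 2 * (z * conj w).re := by
  rw [Complex.sq_norm, Complex.sq_norm, Complex.sq_norm, Complex.normSq_add]

/-- **The `L²` norm is parity-diagonal**: `‖e + o‖₂² = ‖e‖₂² + ‖o‖₂²` (`Re(e · conj o)` is odd). -/
theorem integral_norm_sq_add_of_even_odd (hme : Measurable e) (hze : ∀ x, x ∉ Icc (-a) a → e x = 0)
    (hbe : ∀ x, ‖e x‖ ≤ Se) (hmo : Measurable o) (hzo : ∀ x, x ∉ Icc (-a) a → o x = 0)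
    (hbo : ∀ x, ‖o x‖ ≤ So) (he : ∀ x, e (-x) = e x) (ho : ∀ x, o (-x) = -o x) :
    ∫ x, ‖(e + o) x‖ ^ 2 = (∫ x, ‖e x‖ ^ 2) + ∫ x, ‖o x‖ ^ 2 := by
  have hie : Integrable fun x ↦ ‖e x‖ ^ 2 := by
    have := integrable_norm_sub_sq_window hme hze hbe 0
    have h0 : ∀ x, x ∉ Icc (-a) a → (0 : ℝ → ℂ) x = 0 := fun _ _ ↦ rfl
    -- simpler: `‖e‖² = Re(e conj e)`-free route via the product lemma
    have hp := (integrable_window_mul_window hme hze hbe hme hbe).re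
    refine hp.congr (Eventually.of_forall fun x ↦ ?_)
    simp only [Complex.mul_conj, Complex.sq_norm]
    norm_cast
  have hio : Integrable fun x ↦ ‖o x‖ ^ 2 := by
    have hp := (integrable_window_mul_window hmo hzo hbo hmo hbo).re
    refine hp.congr (Eventually.of_forall fun x ↦ ?_)
    simp only [Complex.mul_conj, Complex.sq_norm]
    norm_cast
  have hcross : Integrable fun x ↦ 2 * (e x * conj (o x)).re :=
    ((integrable_window_mul_window hme hze hbe hmo hbo).re).const_mul 2
  have hodd : ∫ x, 2 * (e x * conj (o x)).re = 0 := by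
    rw [integral_const_mul]
    have : ∫ x, (e x * conj (o x)).re = 0 := by
      have hz : ∫ x, e x * conj (o x) = 0 :=
        integral_eq_zero_of_odd fun x ↦ by rw [he, ho, map_neg]; ring
      have h1 := integral_re (integrable_window_mul_window hme hze hbe hmo hbo)
      simp only [RCLike.re_to_complex] at h1
      rw [h1, hz, Complex.zero_re]
    rw [this, mul_zero]
  simp only [Pi.add_apply, norm_add_sq_complex]
  have hsum : Integrable (fun x ↦ ‖e x‖ ^ 2 + ‖o x‖ ^ 2) := hie.add hio
  rw [integral_add hsum hcross, integral_add hie hio, hodd, add_zero]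

/-- **Every increment is parity-diagonal**: `D_t(e + o) = D_t(e) + D_t(o)` — the cross term
`Re((e(x+t) − e(x)) conj(o(x+t) − o(x)))` is odd under `x ↦ −x − t`. -/
theorem weilIncrement_add_of_even_odd (hme : Measurable e) (hze : ∀ x, x ∉ Icc (-a) a → e x = 0)
    (hbe : ∀ x, ‖e x‖ ≤ Se) (hmo : Measurable o) (hzo : ∀ x, x ∉ Icc (-a) a → o x = 0)
    (hbo : ∀ x, ‖o x‖ ≤ So) (he : ∀ x, e (-x) = e x) (ho : ∀ x, o (-x) = -o x) (t : ℝ) :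
    weilIncrement (e + o) t = weilIncrement e t + weilIncrement o t := by
  have hS : 0 ≤ Se := (norm_nonneg _).trans (hbe 0)
  have hS' : 0 ≤ So := (norm_nonneg _).trans (hbo 0)
  unfold weilIncrement
  have hie := integrable_norm_sub_sq_window hme hze hbe t
  have hio := integrable_norm_sub_sq_window hmo hzo hbo t
  -- the cross term and its integrability
  set E : ℝ → ℂ := fun x ↦ e (x + t) - e x with hE
  set O : ℝ → ℂ := fun x ↦ o (x + t) - o x with hO
  have hmE : Measurable E := (hme.comp (measurable_id.add_const t)).sub hme
  have hmO : Measurable O := (hmo.comp (measurable_id.add_const t)).sub hmo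
  have hbE : ∀ x, ‖E x‖ ≤ 2 * Se := fun x ↦ by
    calc ‖E x‖ ≤ ‖e (x + t)‖ + ‖e x‖ := norm_sub_le _ _
      _ ≤ Se + Se := add_le_add (hbe _) (hbe _)
      _ = 2 * Se := by ring
  have hbO : ∀ x, ‖O x‖ ≤ 2 * So := fun x ↦ by
    calc ‖O x‖ ≤ ‖o (x + t)‖ + ‖o x‖ := norm_sub_le _ _
      _ ≤ So + So := add_le_add (hbo _) (hbo _)
      _ = 2 * So := by ring
  have hzE : ∀ x, x ∉ Icc (-a - |t|) (a + |t|) → E x = 0 := by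
    intro x hx
    rw [mem_Icc, not_and_or, not_le, not_le] at hx
    have hx1 : x ∉ Icc (-a) a := by
      intro h; rcases hx with h' | h' <;> linarith [h.1, h.2, abs_nonneg t]
    have hx2 : x + t ∉ Icc (-a) a := by
      intro h; rcases hx with h' | h' <;> linarith [h.1, h.2, le_abs_self t, neg_abs_le t]
    simp [hE, hze _ hx1, hze _ hx2]
  have hcrossI : Integrable fun x ↦ E x * conj (O x) := by
    have hint : Integrable fun x ↦ (Icc (-a - |t|) (a + |t|)).indicator (fun _ ↦ (2 * Se) * (2 * So)) x :=
      (integrable_indicator_iff measurableSet_Icc).2 (integrableOn_const (by simp [Real.volume_Icc]))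
    refine hint.mono' ((hmE.mul (Complex.continuous_conj.measurable.comp hmO)).aestronglyMeasurable)
      (Eventually.of_forall fun x ↦ ?_)
    by_cases hx : x ∈ Icc (-a - |t|) (a + |t|)
    · rw [indicator_of_mem hx, norm_mul, Complex.norm_conj]
      exact mul_le_mul (hbE x) (hbO x) (norm_nonneg _) (by positivity)
    · rw [hzE x hx, indicator_of_notMem hx, zero_mul, norm_zero]
  have hodd : ∫ x, 2 * (E x * conj (O x)).re = 0 := by
    rw [integral_const_mul]
    have h0 : ∫ x, (E x * conj (O x)).re = 0 := by
      refine integral_eq_zero_of_odd_reflect (t := t) fun x ↦ ?_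
      have hEx : E (-x - t) = -E x := by
        simp only [hE]
        rw [show -x - t + t = -x by ring, he, show -x - t = -(x + t) by ring, he]
        ring
      have hOx : O (-x - t) = O x := by
        simp only [hO]
        rw [show -x - t + t = -x by ring, ho, show -x - t = -(x + t) by ring, ho]
        ring
      rw [hEx, hOx]
      simp
    rw [h0, mul_zero]
  have hodd' : ∫ x, 2 * ((e (x + t) - e x) * conj (o (x + t) - o x)).re = 0 := by
    simpa only [hE, hO] using hodd
  have hcr : Integrable fun x ↦ 2 * ((e (x + t) - e x) * conj (o (x + t) - o x)).re := by
    have h := (hcrossI.re).const_mul 2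
    refine h.congr (Eventually.of_forall fun x ↦ ?_)
    simp only [hE, hO, RCLike.re_to_complex]
  have hpt : ∀ x, ‖(e + o) (x + t) - (e + o) x‖ ^ 2 =
      ‖e (x + t) - e x‖ ^ 2 + ‖o (x + t) - o x‖ ^ 2 +
        2 * ((e (x + t) - e x) * conj (o (x + t) - o x)).re := by
    intro x
    rw [← norm_add_sq_complex]
    congr 1
    simp only [Pi.add_apply]
    ring
  simp_rw [hpt]
  have hsum : Integrable (fun x ↦ ‖e (x + t) - e x‖ ^ 2 + ‖o (x + t) - o x‖ ^ 2) := hie.add hio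
  rw [integral_add hsum hcr, integral_add hie hio, hodd', add_zero]

/-- **The window form is parity-additive**: `weilWindowForm a (e + o) = weilWindowForm a e +
weilWindowForm a o` for an even and an odd window function (all supported in `[-a, a]`, measurable,
bounded). -/
theorem weilWindowForm_add_of_even_odd (ha : 0 ≤ a) (hme : Measurable e)
    (hze : ∀ x, x ∉ Icc (-a) a → e x = 0) (hbe : ∀ x, ‖e x‖ ≤ Se)
    (hle : ∀ x y, x ∈ Icc (-a) a → y ∈ Icc (-a) a → ‖e y - e x‖ ≤ Le * |y - x|)
    (hmo : Measurable o) (hzo : ∀ x, x ∉ Icc (-a) a → o x = 0) (hbo : ∀ x, ‖o x‖ ≤ So)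
    (hlo : ∀ x y, x ∈ Icc (-a) a → y ∈ Icc (-a) a → ‖o y - o x‖ ≤ Lo * |y - x|)
    (he : ∀ x, e (-x) = e x) (ho : ∀ x, o (-x) = -o x) (b : ℝ) :
    weilWindowForm b (e + o) = weilWindowForm b e + weilWindowForm b o := by
  unfold weilWindowForm weilDirichletEnergy
  rw [weilPoleForm_add_of_even_odd hme hze hbe hmo hzo hbo he ho,
    integral_norm_sq_add_of_even_odd hme hze hbe hmo hzo hbo he ho]
  simp_rw [weilIncrement_add_of_even_odd hme hze hbe hmo hzo hbo he ho]
  have hIe := integrableOn_weilArchDensity_mul_weilIncrement_window ha hme hze hbe hle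
  have hIo := integrableOn_weilArchDensity_mul_weilIncrement_window ha hmo hzo hbo hlo
  have harch : ∫ t in Ioi (0 : ℝ), weilArchDensity t * (weilIncrement e t + weilIncrement o t) =
      (∫ t in Ioi (0 : ℝ), weilArchDensity t * weilIncrement e t) +
        ∫ t in Ioi (0 : ℝ), weilArchDensity t * weilIncrement o t := by
    rw [← integral_add hIe hIo]
    exact integral_congr_ae (Eventually.of_forall fun t ↦ mul_add _ _ _)
  rw [harch, Finset.sum_congr rfl fun n _ ↦ mul_add _ _ _, Finset.sum_add_distrib]
  ring

end Window

end Summit.RiemannHypothesis.RiemannHypothesis.Theorems.WeilFormatC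

end
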